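import Summits.NavierStokesRegularity.NavierStokesRegularity.Theorems.HeredityAtOne.Negative.NoSwirlSliceStratum
import Summits.NavierStokesRegularity.NavierStokesRegularity.Theorems.HeredityAtOne.Negative.CapStratum
import Summits.NavierStokesRegularity.FluidComputer.PalasekTowerHeredityOrBreakdownCeiling

/-!
# The cap class is (C)-STERILE: its hosts live forever, obey the window ceiling, and kill the WEAK item too

Cell `ns-blowup`, seat `refuter-ns-palasek-19249-disprove-1` (g3; DISPROVER, route `PalasekTowerBreakdown`, item
stmt-NavierStokesRegularity-19249 `HeredityAtOne`). NEGATIVE-LANE lemmas (no positive Theses conclusion), sorry-free, no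
named fact, no new definition.

The T2-r3 supplement's conditional lever against the `∀`-form of `HeredityAtOne` is a registered level-1 stage in the
Gallay–Šverák capped class (`CappedStageAt 1`, abstractly; the capped signed swirl-free stratum `InCapStratum 1`,
concretely, constant `0.35356`). The tree already knows `CappedStageAt 1 → ¬ HeredityAtOne` (p448312) and that the
lever bears on the SPEED stub (`not_speedFloorAt_of_cappedStageAt`, p480736). By
`palasekTowerBreakdown_not_heredityAtOne_dichotomy` any refutation of the item either refutes its WEAK form
`HeredityOrBreakdownAt 1` or proves Fefferman's (C). This file decides the dichotomy ON THE LEVER: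

* §1 **the host LIVES FOREVER** — a speed-bounded unforced future makes the design globally regular
  (`exists_global_solution_of_speed_bound`, Leray–Clay dichotomy), so a capped host is never a breakdown door:
  `S.LivesTo 1 T` for every `T > 0`; in particular the `NoPrematureBreakdownAt k` instance of the host HOLDS;
* §2 **the WEAK item dies on the cap class as well**: `CappedStageAt k → ¬ HeredityOrBreakdownAt k` (`k ≥ 1`), and on
  the stratum `InCapStratum k S s → ¬ HeredityOrBreakdownAt k`; so `HeredityOrBreakdownAt 1 → CapStratumEmptyAt 1` —
  weakening binder 2 of the route to its or-breakdown form does NOT immunise it against this lane;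
* §4 **lossless splits**: ON the stratum both the item and its weak form hold only vacuously —
  `heredityOnStratum_iff_empty`, `orBreakdownOnStratum_iff_empty`, `heredityOrBreakdownAt_iff_offStratum_and_empty`;
* §3 **per-stub exposure of the line `Lines/birth.lean` v4** (five stubs): on a capped host the instances of
  `stub_no_premature_breakdown_at_one` (§1) and `stub_window_ceiling_at_one` (uniqueness + the cap, `B ≤ c₂ Y₂`) HOLD,
  the instance of `stub_speed_floor_at_one` FAILS (p480736); strain / core stubs are cap-blind. The cap class bears
  on exactly one of the five v4 stubs, and (C) cannot be harvested from it.

All premises are empty-in-practice (no registered level-1 stage is constructible: `EpisodeBaseG`, item 19179, is open;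
`capStratumEmptyAt_one_of_not_episodeBaseG`). [cite: GallaySverak2016, Prop. 2.6 (2.14)] [cite: Leray1934, §32]
[cite: Sohr2001, Ch. V Thm. 1.5.1] [cite: Palasek2026ElementaryModel, §4]
-/

noncomputable section

namespace Summit.NavierStokesRegularity.HeredityAtOneCapSterile

open Set MeasureTheory Filter Topology Function
open scoped ENNReal NNReal
open Literature.Analysis.FluidPDE
open Summit.NavierStokesRegularity.FluidComputer
open Summit.NavierStokesRegularity.FluidComputer.PalasekTowerClayBridge
open Summit.NavierStokesRegularity.NavierStokesRegularity
open Summit.NavierStokesRegularity.HeredityAtOneNoSwirlCap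
open Summit.NavierStokesRegularity.HeredityAtOneSpeedCap
open Summit.NavierStokesRegularity.HeredityAtOneNoSwirlStratum

variable {k : ℕ} {S : Schedule TowerRates.wide}

/-! ## §1 Capped hosts live forever -/

/-- **A speed-bounded unforced future ⇒ the design lives to every `T > 0`** (`k ≥ 1`, quiet design): the global
classical solution of `exists_global_solution_of_speed_bound`, restricted to `[0, T]`. [cite: Leray1934, §32]
[cite: Sohr2001, Ch. V Thm. 1.5.1] -/
theorem livesTo_of_speed_bound (hk : 1 ≤ k) (hQ : S.Quiet)
    (s : Stage 1 TowerRates.wide S (Margins.routeG TowerRates.wide) k) {B : ℝ} (hbd : WindowSpeedCap {s.u (S.τ k)} (fun _ => B))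
    {T : ℝ} (hT : 0 < T) : S.LivesTo 1 T := by
  obtain ⟨U, P, hcl, h0, ⟨C, hC, hb⟩, -, -⟩ := exists_global_solution_of_speed_bound hk s hQ
    ((windowSpeedCap_singleton_const_iff _ _).1 hbd)
  exact ⟨U, P, hcl.mono (fun _ ht => ht.1) (uniqueDiffOn_Icc hT), h0, C, hC, fun t ht => hb t ht.1⟩

/-- **A registered signed swirl-free slice ⇒ the design lives to every `T > 0`** (`k ≥ 1`, quiet design; NO
smallness of the cap value): Gallay–Šverák's cap (constant `0.35356`) is a speed bound on every unforced future.
[cite: GallaySverak2016, Prop. 2.6 (2.14)] [cite: Leray1934, §32] -/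
theorem livesTo_of_signedNoSwirlSlice (hk : 1 ≤ k) (hQ : S.Quiet)
    (s : Stage 1 TowerRates.wide S (Margins.routeG TowerRates.wide) k) {M : ℝ}
    (hsl : SignedNoSwirlSlice (s.u (S.τ k)) M) {T : ℝ} (hT : 0 < T) : S.LivesTo 1 T :=
  livesTo_of_speed_bound hk hQ s (windowSpeedCap_slice isNoSwirlCapConstant_eighth s hsl) hT

/-- **Stratum hosts live forever.** [cite: GallaySverak2016, Prop. 2.6 (2.14)] -/
theorem livesTo_of_inCapStratum (hk : 1 ≤ k) (hQ : S.Quiet)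
    (s : Stage 1 TowerRates.wide S (Margins.routeG TowerRates.wide) k) (h : InCapStratum k S s)
    {T : ℝ} (hT : 0 < T) : S.LivesTo 1 T := by
  obtain ⟨M, hsl, -⟩ := h
  exact livesTo_of_signedNoSwirlSlice hk hQ s hsl hT

/-- **The abstract cap class yields a host living forever** (the `S, s` of `CappedStageAt k`, `k ≥ 1`).
[cite: Leray1934, §32] -/
theorem exists_immortal_host_of_cappedStageAt (hk : 1 ≤ k) (hW : CappedStageAt k) :
    ∃ (S : Schedule TowerRates.wide) (s : Stage 1 TowerRates.wide S (Margins.routeG TowerRates.wide) k) (B : ℝ),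
      S.Pins 8 (6 / 5) ∧ S.Rigid ∧ S.Quiet ∧ B < S.c₁ * TowerRates.wide.Y (k + 1) ∧
      WindowSpeedCap {s.u (S.τ k)} (fun _ => B) ∧
      ∀ T, 0 < T → S.LivesTo 1 T := by
  obtain ⟨S, s, B, hP, hR, hQ, hBlt, hcap⟩ := (cappedStageAt_iff_exists_speed_bound k).1 hW
  have hcap' : WindowSpeedCap {s.u (S.τ k)} (fun _ => B) := (windowSpeedCap_singleton_const_iff _ _).2 hcap
  exact ⟨S, s, B, hP, hR, hQ, hBlt, hcap', fun T hT => livesTo_of_speed_bound hk hQ s hcap' hT⟩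

/-! ## §2 The WEAK item `HeredityOrBreakdownAt k` dies on the cap class -/

/-- **Instance kill**: a pinned rigid quiet wide design with a registered level-`k` stage (`k ≥ 1`) whose unforced
futures are speed-bounded by `B < c₁ Y_{k+1}` falsifies the `HeredityOrBreakdownAt k` instance at `(S, s)`: the
design lives to `τ_{k+1}` (§1), and an extension stage would be an unforced finite-energy classical run from the
slice on `[τ_k, τ_{k+1}]`, capped by `B` against its own floor `c₁ Y_{k+1}`. [cite: Palasek2026ElementaryModel, §4] -/
theorem not_orBreakdown_instance_of_speed_bound (hk : 1 ≤ k) (hQ : S.Quiet)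
    (s : Stage 1 TowerRates.wide S (Margins.routeG TowerRates.wide) k) {B : ℝ}
    (hBlt : B < S.c₁ * TowerRates.wide.Y (k + 1)) (hbd : WindowSpeedCap {s.u (S.τ k)} (fun _ => B)) :
    ¬ (¬ S.LivesTo 1 (S.τ (k + 1)) ∨
        ∃ s' : Stage 1 TowerRates.wide S (Margins.routeG TowerRates.wide) (k + 1), s.Extends s') := by
  rintro (hdead | ⟨s', hs'⟩)
  · exact hdead (livesTo_of_speed_bound hk hQ s hbd (S.τ_pos (k + 1)))
  · have hτ : S.τ k < S.τ (k + 1) := S.τ_lt_succ k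
    have hcl : IsClassicalNSSolutionOn (Icc (S.τ k) (S.τ (k + 1))) 1 S.f s'.u s'.p :=
      s'.classical.mono (Icc_subset_Icc_left (S.τ_pos k).le) (uniqueDiffOn_Icc hτ)
    have hf0 : ∀ t ∈ Icc (S.τ k) (S.τ (k + 1)), S.f t = 0 :=
      fun t ht => hQ t ((S.τ_mono hk).trans ht.1)
    have hE : ∃ C : ℝ≥0∞, C < ⊤ ∧ ∀ t ∈ Icc (S.τ k) (S.τ (k + 1)), ∫⁻ x, ‖s'.u t x‖ₑ ^ 2 ≤ C := by
      obtain ⟨C, hC, hb⟩ := s'.energy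
      exact ⟨C, hC, fun t ht => hb t ⟨(S.τ_pos k).le.trans ht.1, ht.2⟩⟩
    have hk0 : s'.u (S.τ k) = s.u (S.τ k) := (hs' (S.τ k) ⟨(S.τ_pos k).le, le_rfl⟩).1
    obtain ⟨x, -, hfl⟩ := s'.floor (k + 1) le_rfl
    have hle := (windowSpeedCap_singleton_const_iff _ _).1 hbd hτ S.f s'.u s'.p hcl hf0 hE hk0
      (S.τ (k + 1)) ⟨hτ.le, le_rfl⟩ x
    linarith

/-- **`CappedStageAt k → ¬ HeredityOrBreakdownAt k`** (`k ≥ 1`): the abstract cap lever kills the WEAK item —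
«heredity or breakdown» — as well, unconditionally in the witness; the breakdown disjunct is closed by §1.
[cite: Palasek2026ElementaryModel, §4] [cite: Leray1934, §32] -/
theorem not_heredityOrBreakdownAt_of_cappedStageAt (hk : 1 ≤ k) (hW : CappedStageAt k) :
    ¬ HeredityOrBreakdownAt k := by
  obtain ⟨S, s, B, hP, hR, hQ, hBlt, hcap⟩ := (cappedStageAt_iff_exists_speed_bound k).1 hW
  exact fun h => not_orBreakdown_instance_of_speed_bound hk hQ s hBlt
    ((windowSpeedCap_singleton_const_iff _ _).2 hcap) (h S hP hR hQ s)

/-- The first rung by name: `CappedStageAtOne → ¬ HeredityOrBreakdownAt 1`. [cite: Palasek2026ElementaryModel, §4] -/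
theorem not_heredityOrBreakdownAt_one_of_cappedStageAtOne (hW : CappedStageAtOne) :
    ¬ HeredityOrBreakdownAt 1 :=
  not_heredityOrBreakdownAt_of_cappedStageAt le_rfl hW

/-- **Every member of the stratum `𝒮_k` falsifies `HeredityOrBreakdownAt k`** (`k ≥ 1`, number `0.35356`).
[cite: GallaySverak2016, Prop. 2.6 (2.14)] [cite: Palasek2026ElementaryModel, §4] -/
theorem not_heredityOrBreakdownAt_of_inCapStratum (hk : 1 ≤ k) (hP : S.Pins 8 (6 / 5)) (hR : S.Rigid)
    (hQ : S.Quiet) (s : Stage 1 TowerRates.wide S (Margins.routeG TowerRates.wide) k)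
    (h : InCapStratum k S s) : ¬ HeredityOrBreakdownAt k := by
  obtain ⟨M, hsl, hlt⟩ := h
  exact fun hH => not_orBreakdown_instance_of_speed_bound hk hQ s hlt
    (windowSpeedCap_slice isNoSwirlCapConstant_eighth s hsl) (hH S hP hR hQ s)

/-- **The weak item also needs the stratum EMPTY**: `HeredityOrBreakdownAt k → CapStratumEmptyAt k` (`k ≥ 1`).
[cite: Palasek2026ElementaryModel, §4] -/
theorem capStratumEmptyAt_of_heredityOrBreakdownAt (hk : 1 ≤ k) (h : HeredityOrBreakdownAt k) :
    CapStratumEmptyAt k :=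
  fun _ hP hR hQ s hs => not_heredityOrBreakdownAt_of_inCapStratum hk hP hR hQ s hs h

/-- At the first rung: `HeredityOrBreakdownAt 1 → CapStratumEmptyAt 1`. [cite: Palasek2026ElementaryModel, §4] -/
theorem capStratumEmptyAt_one_of_heredityOrBreakdownAt_one (h : HeredityOrBreakdownAt 1) :
    CapStratumEmptyAt 1 :=
  capStratumEmptyAt_of_heredityOrBreakdownAt le_rfl h

/-- **The dichotomy decided on the lever.** `palasekTowerBreakdown_not_heredityAtOne_dichotomy` says a refutation
of `HeredityAtOne` refutes `HeredityOrBreakdownAt 1` or proves (C); a stratum host does the FIRST and lives forever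
(so it is no (C) door). [cite: FeffermanClay2006, (C)] [cite: GallaySverak2016, Prop. 2.6 (2.14)] -/
theorem dichotomy_on_stratum (hP : S.Pins 8 (6 / 5)) (hR : S.Rigid) (hQ : S.Quiet)
    (s : Stage 1 TowerRates.wide S (Margins.routeG TowerRates.wide) 1) (h : InCapStratum 1 S s) :
    ¬ Theses.PalasekTowerBreakdown.HeredityAtOne ∧ ¬ HeredityOrBreakdownAt 1 ∧ ∀ T, 0 < T → S.LivesTo 1 T :=
  ⟨heredityAtOne_false_of_inCapStratum hP hR hQ s h, not_heredityOrBreakdownAt_of_inCapStratum le_rfl hP hR hQ s h,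
    fun _ hT => livesTo_of_inCapStratum le_rfl hQ s h hT⟩

/-! ## §3 Per-stub exposure of `Lines/birth.lean` v4 on capped hosts -/

/-- **`stub_no_premature_breakdown_at_one`'s instance HOLDS on every signed swirl-free registered host** (`k ≥ 1`,
no cap smallness): the design lives to `τ_{k+1}`. [cite: GallaySverak2016, Prop. 2.6 (2.14)] -/
theorem noPrematureBreakdown_instance_of_signedNoSwirlSlice (hk : 1 ≤ k) (hQ : S.Quiet)
    (s : Stage 1 TowerRates.wide S (Margins.routeG TowerRates.wide) k) {M : ℝ}
    (hsl : SignedNoSwirlSlice (s.u (S.τ k)) M) : S.LivesTo 1 (S.τ (k + 1)) :=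
  livesTo_of_signedNoSwirlSlice hk hQ s hsl (S.τ_pos (k + 1))

/-- **`stub_window_ceiling_at_one`'s instance HOLDS on every capped host with `B ≤ c₂ Y_{k+1}`** (`k ≥ 1`): a
classical finite-energy solution `(v, q)` of the design's system from its datum on `[0, τ_{k+1}]` IS the stage on
`[0, τ_k]` (forced weak–strong uniqueness, `Stage.velocity_eq_of_classical`), hence an unforced finite-energy run
from the slice on the window, capped by `B`. [cite: Sohr2001, Ch. V Thm. 1.5.1] [cite: Palasek2026ElementaryModel, §4] -/
theorem windowCeiling_instance_of_speed_bound (hk : 1 ≤ k) (hQ : S.Quiet)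
    (s : Stage 1 TowerRates.wide S (Margins.routeG TowerRates.wide) k) {B : ℝ}
    (hB : B ≤ S.c₂ * TowerRates.wide.Y (k + 1)) (hbd : WindowSpeedCap {s.u (S.τ k)} (fun _ => B))
    (v : ℝ → EuclideanSpace ℝ (Fin 3) → EuclideanSpace ℝ (Fin 3)) (q : ℝ → EuclideanSpace ℝ (Fin 3) → ℝ)
    (hcl : IsClassicalNSSolutionOn (Icc 0 (S.τ (k + 1))) 1 S.f v q) (hv0 : v 0 = S.u₀)
    (hE : ∃ C : ℝ≥0∞, C < ⊤ ∧ ∀ t ∈ Icc 0 (S.τ (k + 1)), ∫⁻ x, ‖v t x‖ₑ ^ 2 ≤ C) :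
    ∀ t ∈ Icc (S.τ k) (S.τ (k + 1)), ∀ x, ‖v t x‖ ≤ S.c₂ * TowerRates.wide.Y (k + 1) := by
  have hτ : S.τ k < S.τ (k + 1) := S.τ_lt_succ k
  have hvk : v (S.τ k) = s.u (S.τ k) :=
    s.velocity_eq_of_classical one_pos hτ.le hcl hv0 hE (S.τ k) ⟨(S.τ_pos k).le, le_rfl⟩
  have hclw : IsClassicalNSSolutionOn (Icc (S.τ k) (S.τ (k + 1))) 1 S.f v q :=
    hcl.mono (Icc_subset_Icc_left (S.τ_pos k).le) (uniqueDiffOn_Icc hτ)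
  have hf0 : ∀ t ∈ Icc (S.τ k) (S.τ (k + 1)), S.f t = 0 :=
    fun t ht => hQ t ((S.τ_mono hk).trans ht.1)
  have hEw : ∃ C : ℝ≥0∞, C < ⊤ ∧ ∀ t ∈ Icc (S.τ k) (S.τ (k + 1)), ∫⁻ x, ‖v t x‖ₑ ^ 2 ≤ C := by
    obtain ⟨C, hC, hb⟩ := hE
    exact ⟨C, hC, fun t ht => hb t ⟨(S.τ_pos k).le.trans ht.1, ht.2⟩⟩
  intro t ht x
  exact ((windowSpeedCap_singleton_const_iff _ _).1 hbd hτ S.f v q hclw hf0 hEw hvk t ht x).trans hB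

/-- **`stub_window_ceiling_at_one`'s instance HOLDS on every stratum host** (`k ≥ 1`; cap value `< c₁ Y_{k+1} ≤
c₂ Y_{k+1}`). [cite: GallaySverak2016, Prop. 2.6 (2.14)] [cite: Sohr2001, Ch. V Thm. 1.5.1] -/
theorem windowCeiling_instance_of_inCapStratum (hk : 1 ≤ k) (hQ : S.Quiet)
    (s : Stage 1 TowerRates.wide S (Margins.routeG TowerRates.wide) k) (h : InCapStratum k S s)
    (v : ℝ → EuclideanSpace ℝ (Fin 3) → EuclideanSpace ℝ (Fin 3)) (q : ℝ → EuclideanSpace ℝ (Fin 3) → ℝ)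
    (hcl : IsClassicalNSSolutionOn (Icc 0 (S.τ (k + 1))) 1 S.f v q) (hv0 : v 0 = S.u₀)
    (hE : ∃ C : ℝ≥0∞, C < ⊤ ∧ ∀ t ∈ Icc 0 (S.τ (k + 1)), ∫⁻ x, ‖v t x‖ₑ ^ 2 ≤ C) :
    ∀ t ∈ Icc (S.τ k) (S.τ (k + 1)), ∀ x, ‖v t x‖ ≤ S.c₂ * TowerRates.wide.Y (k + 1) := by
  obtain ⟨M, hsl, hlt⟩ := h
  have hY : 0 < TowerRates.wide.Y (k + 1) := Real.rpow_pos_of_pos (TowerRates.wide.N_pos (k + 1)) _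
  exact windowCeiling_instance_of_speed_bound hk hQ s
    (hlt.le.trans (mul_le_mul_of_nonneg_right s.c₁_le_c₂ hY.le))
    (windowSpeedCap_slice isNoSwirlCapConstant_eighth s hsl) v q hcl hv0 hE

/-- **`stub_speed_floor_at_one`'s instance FAILS on every stratum host** — by name (p480736): one member of `𝒮₁`
refutes `SpeedFloorAt 1`. [cite: GallaySverak2016, Prop. 2.6 (2.14)] -/
theorem not_speedFloorAt_one_of_inCapStratum (hP : S.Pins 8 (6 / 5)) (hR : S.Rigid) (hQ : S.Quiet)
    (s : Stage 1 TowerRates.wide S (Margins.routeG TowerRates.wide) 1) (h : InCapStratum 1 S s) :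
    ¬ SpeedFloorAt 1 := by
  obtain ⟨M, hsl, hlt⟩ := h
  exact not_speedFloorAt_one_of_signedNoSwirlSlice_eighth hP hR hQ s hsl hlt

/-- **THE v4 EXPOSURE TABLE on a stratum host at level 1**: the design lives to `τ₂` (stub 1's instance holds),
every life of the design obeys the window ceiling `c₂ Y₂` on `[τ₁, τ₂]` (stub 2's instance holds), and
`SpeedFloorAt 1` (stub 3) is false; so are the item and its weak form. Strain / core stubs are not touched.
[cite: GallaySverak2016, Prop. 2.6 (2.14)] [cite: Palasek2026ElementaryModel, §4] -/
theorem v4_exposure_of_inCapStratum_one (hP : S.Pins 8 (6 / 5)) (hR : S.Rigid) (hQ : S.Quiet)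
    (s : Stage 1 TowerRates.wide S (Margins.routeG TowerRates.wide) 1) (h : InCapStratum 1 S s) :
    S.LivesTo 1 (S.τ 2) ∧
      (∀ (v : ℝ → EuclideanSpace ℝ (Fin 3) → EuclideanSpace ℝ (Fin 3)) (q : ℝ → EuclideanSpace ℝ (Fin 3) → ℝ),
        IsClassicalNSSolutionOn (Icc 0 (S.τ 2)) 1 S.f v q → v 0 = S.u₀ →
        (∃ C : ℝ≥0∞, C < ⊤ ∧ ∀ t ∈ Icc 0 (S.τ 2), ∫⁻ x, ‖v t x‖ₑ ^ 2 ≤ C) →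
        ∀ t ∈ Icc (S.τ 1) (S.τ 2), ∀ x, ‖v t x‖ ≤ S.c₂ * TowerRates.wide.Y 2) ∧
      ¬ SpeedFloorAt 1 ∧ ¬ HeredityOrBreakdownAt 1 ∧ ¬ Theses.PalasekTowerBreakdown.HeredityAtOne :=
  ⟨livesTo_of_inCapStratum le_rfl hQ s h (S.τ_pos 2), windowCeiling_instance_of_inCapStratum le_rfl hQ s h,
    not_speedFloorAt_one_of_inCapStratum hP hR hQ s h, not_heredityOrBreakdownAt_of_inCapStratum le_rfl hP hR hQ s h,
    heredityAtOne_false_of_inCapStratum hP hR hQ s h⟩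

/-! ## §4 Lossless splits: ON the stratum both items are TRUE ONLY VACUOUSLY -/

/-- **Heredity ON the stratum ⇔ the stratum is EMPTY** (`k ≥ 1`): the `∀`-form of `HeredityAt k` restricted to
capped signed swirl-free registered hosts holds iff there is no such host — on the lever the item has no content but
emptiness. [cite: GallaySverak2016, Prop. 2.6 (2.14)] [cite: Palasek2026ElementaryModel, §4] -/
theorem heredityOnStratum_iff_empty (hk : 1 ≤ k) :
    (∀ S : Schedule TowerRates.wide, S.Pins 8 (6 / 5) → S.Rigid → S.Quiet →
        ∀ s : Stage 1 TowerRates.wide S (Margins.routeG TowerRates.wide) k, InCapStratum k S s →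
          ∃ s' : Stage 1 TowerRates.wide S (Margins.routeG TowerRates.wide) (k + 1), s.Extends s') ↔
      CapStratumEmptyAt k := by
  refine ⟨fun h S hP hR hQ s hs => ?_, fun h S hP hR hQ s hs => absurd hs (h S hP hR hQ s)⟩
  obtain ⟨M, hsl, hlt⟩ := hs
  exact not_orBreakdown_instance_of_speed_bound hk hQ s hlt
    (windowSpeedCap_slice isNoSwirlCapConstant_eighth s hsl) (Or.inr (h S hP hR hQ s ⟨M, hsl, hlt⟩))

/-- **«Heredity or breakdown» ON the stratum ⇔ the stratum is EMPTY** (`k ≥ 1`): the weak form restricted to the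
lever is vacuous-or-false as well (hosts live, extensions are capped). [cite: Palasek2026ElementaryModel, §4] -/
theorem orBreakdownOnStratum_iff_empty (hk : 1 ≤ k) :
    (∀ S : Schedule TowerRates.wide, S.Pins 8 (6 / 5) → S.Rigid → S.Quiet →
        ∀ s : Stage 1 TowerRates.wide S (Margins.routeG TowerRates.wide) k, InCapStratum k S s →
          ¬ S.LivesTo 1 (S.τ (k + 1)) ∨
            ∃ s' : Stage 1 TowerRates.wide S (Margins.routeG TowerRates.wide) (k + 1), s.Extends s') ↔
      CapStratumEmptyAt k := by
  refine ⟨fun h S hP hR hQ s hs => ?_, fun h S hP hR hQ s hs => absurd hs (h S hP hR hQ s)⟩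
  obtain ⟨M, hsl, hlt⟩ := hs
  exact not_orBreakdown_instance_of_speed_bound hk hQ s hlt
    (windowSpeedCap_slice isNoSwirlCapConstant_eighth s hsl) (h S hP hR hQ s ⟨M, hsl, hlt⟩)

/-- **THE WEAK ITEM'S LOSSLESS SPLIT** (`k ≥ 1`, def-free off-stratum part): `HeredityOrBreakdownAt k` iff
(«heredity or breakdown» for registered level-`k` stages OFF the stratum) ∧ (the stratum is EMPTY) — the same shape
as `heredityAt_iff_offStratum_and_empty` for the strong item. [cite: Palasek2026ElementaryModel, §4] -/
theorem heredityOrBreakdownAt_iff_offStratum_and_empty (hk : 1 ≤ k) :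
    HeredityOrBreakdownAt k ↔
      (∀ S : Schedule TowerRates.wide, S.Pins 8 (6 / 5) → S.Rigid → S.Quiet →
          ∀ s : Stage 1 TowerRates.wide S (Margins.routeG TowerRates.wide) k, ¬ InCapStratum k S s →
            ¬ S.LivesTo 1 (S.τ (k + 1)) ∨
              ∃ s' : Stage 1 TowerRates.wide S (Margins.routeG TowerRates.wide) (k + 1), s.Extends s') ∧
        CapStratumEmptyAt k := by
  refine ⟨fun h => ⟨fun S hP hR hQ s _ => h S hP hR hQ s, capStratumEmptyAt_of_heredityOrBreakdownAt hk h⟩,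
    fun h S hP hR hQ s => h.1 S hP hR hQ s (h.2 S hP hR hQ s)⟩

/-- The first rung of the weak item, split. [cite: Palasek2026ElementaryModel, §4] -/
theorem heredityOrBreakdownAt_one_iff_offStratum_and_empty :
    HeredityOrBreakdownAt 1 ↔
      (∀ S : Schedule TowerRates.wide, S.Pins 8 (6 / 5) → S.Rigid → S.Quiet →
          ∀ s : Stage 1 TowerRates.wide S (Margins.routeG TowerRates.wide) 1, ¬ InCapStratum 1 S s →
            ¬ S.LivesTo 1 (S.τ 2) ∨
              ∃ s' : Stage 1 TowerRates.wide S (Margins.routeG TowerRates.wide) 2, s.Extends s') ∧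
        CapStratumEmptyAt 1 :=
  heredityOrBreakdownAt_iff_offStratum_and_empty le_rfl

end Summit.NavierStokesRegularity.HeredityAtOneCapSterile

end
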